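import Literature.NumberTheory.GaloisRepresentations.LocalReciprocityProofs
import HarnessLib

/-!
# The local Artin map with its five characterising clauses exists
(discharge of `exists_isLocalArtinMap`; Milne I Thm. 1.1 (b), Serre XIII §4 Thm. 2)

Theorems only.  This leaf file discharges the named fact
`Literature.NumberTheory.GaloisRepresentations.exists_isLocalArtinMap F` of
`LocalClassFieldTheory.lean` (D-0014): for every non-archimedean local field `F` some homomorphism
`artin : W_F →* Fˣ` satisfies `IsLocalArtinMap F artin` — open quotient map, kernel
`closure [W_F, W_F]`, `artin (I_F) = 𝒪_Fˣ`, geometric Frobenius `↦` uniformiser, AND the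
reciprocity law at finite level: for every finite abelian `E/F` inside `F̄`,
`artin w ∈ N_{E/F}(Eˣ) ↔ w|_E = 1`.

The witness is the tree's own Artin map.  The finite-level reciprocity system
`ω = (ω_L : Fˣ → G(L/F))_L` of `F` exists (`LocalWeilDatum.exists_isReciprocitySystem_holds`,
Neukirch's route, `LocalReciprocityNormFunctoriality.lean`); its limit
`θ = IsReciprocitySystem.theta : Fˣ →* Γ_F^ab` (`LocalReciprocityLimitProofs.lean`) is a
reciprocity map with Serre's printed properties (`IsReciprocitySystem.isLocalReciprocityMap_theta`,
fed by `universalNormSubgroup_eq_bot` and `isClosed_of_isNormSubgroup_holds`), and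
`IsLocalReciprocityMap.artin`, `artin w = (θ⁻¹ [w])⁻¹` (Tate (1.4.1)), carries the first four
clauses (`isOpenQuotientMap_artin`, `coe_ker_artin`, `map_inertia_artin`, `isUniformizer_artin`
of `LocalClassFieldTheoryProofs.lean`, the density of `W_F` in `Γ_F` being
`WeilGroup.denseRange_toAbsGalois_holds`).  The only new line is clause (b) for THIS map
(`IsReciprocitySystem.artin_mem_range_norm_iff`), which is the system's own kernel clause
`ker_eq : ker ω_E = N_{E/F}(Eˣ)` (Serre XIII §4, Cor. to Prop. 8) read through the defining
property of `θ`: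

  `artin w ∈ N_E ↔ (artin w)⁻¹ ∈ N_E = ker ω_E ↔ ω_E (artin w)⁻¹ = 1 ↔ w|_E = 1`,

the last step because `θ (artin w)⁻¹ = [w]` (`theta_artin_inv`) means that `w ∈ Γ_F` represents
`θ (artin w)⁻¹`, i.e. `w|_E = ω_E (artin w)⁻¹` for every finite abelian `E`
(`restrictNormalHom_eq_of_absGaloisAbProj_eq`), and `w|_E = 1 ↔ w ∈ Gal(F̄/E)`
(`IntermediateField.restrictNormalHom_ker`).  The general existence theorem
`exists_isLocalReciprocityMap_holds` forgets the system `ω`, which is why the chain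
system `→` limit map `→` Artin map is redone here with the system in hand.

## Main results

* `IsReciprocitySystem.artin_mem_range_norm_iff`: clause (b) for the Artin map of `θ = theta`;
* `IsReciprocitySystem.isLocalArtinMap_artin`, `IsReciprocitySystem.isLocalArtinMap_artin_theta`:
  that Artin map has all five clauses (given, resp. fed with, the density of `W_F`);
* `exists_isLocalArtinMap_of_exists_isReciprocitySystem`, `exists_isLocalArtinMap_holds`:
  the named fact, from a reciprocity system alone resp. unconditionally;
* `isLocalArtinMap_canonicalArtin_holds`: the pinned map `canonicalArtin F` has the five clauses.

Not here: uniqueness (`IsLocalArtinMap.unique`, the sibling debt of the pin), and any statement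
about `canonicalArtin F` beyond its clauses.

## References

* J.-P. Serre, *Local Fields*, GTM 67, Springer 1979, Ch. XIII §4 (Thm. 1–2, Prop. 8 Cor.,
  Prop. 12, Prop. 13 and Cor.), Ch. XIV §6 (Thm. 1, Cor. 2, Remark 2).  [SerreLocalFields1979]
* J. Tate, *Number theoretic background*, Proc. Sympos. Pure Math. XXXIII (Corvallis 1977),
  Part 2, AMS 1979, (1.4.1)–(1.4.6).  [Corvallis1979]
* J. S. Milne, *Class Field Theory* (course notes), Ch. I, Thm. 1.1 (a)–(b).
-/

noncomputable section

open ValuativeRel Field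

namespace Literature.NumberTheory.GaloisRepresentations

universe u

namespace IsReciprocitySystem

variable {F : Type*} [Field F] [ValuativeRel F] [TopologicalSpace F] [IsNonarchimedeanLocalField F]
variable {ω : (L : IntermediateField F (AlgebraicClosure F)) → Fˣ →* (L ≃ₐ[F] L)}
variable (hω : IsReciprocitySystem F ω)

/-- **The reciprocity law at finite level for the Artin map of `θ`** (clause (b) of
`IsLocalArtinMap`; Milne I Thm. 1.1 (b), Serre XIII §4 Thm. 2): for the limit map `θ` of a
reciprocity system `ω` (assumed to be a reciprocity map, `hθ`) and its Artin map
`artin w = (θ⁻¹ [w])⁻¹` on the Weil group, `artin w` is a norm from a finite abelian `E ⊆ F̄` iff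
`w` fixes `E` pointwise.  Proof: `N_{E/F}(Eˣ) = ker ω_E` (`ker_eq`) is a subgroup, so
`artin w ∈ N_E ↔ ω_E (artin w)⁻¹ = 1`; and `θ (artin w)⁻¹ = [w]` (`theta_artin_inv`) says that `w`
represents `θ (artin w)⁻¹`, so `ω_E (artin w)⁻¹ = w|_E` (`restrictNormalHom_eq_of_absGaloisAbProj_eq`),
which is `1` iff `w ∈ Gal(F̄/E)` (`IntermediateField.restrictNormalHom_ker`).
[cite: SerreLocalFields1979, Ch. XIII §4 Thm. 2 and Prop. 8 Cor.] -/
theorem artin_mem_range_norm_iff (hθ : IsLocalReciprocityMap F hω.theta)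
    (E : IntermediateField F (AlgebraicClosure F)) [FiniteDimensional F E] [IsAbelianGalois F E]
    (w : WeilGroup F) :
    hθ.artin w ∈ (Units.map (Algebra.norm F : E →* F)).range ↔
      WeilGroup.toAbsGalois F w ∈ E.fixingSubgroup := by
  rw [← inv_mem_iff (x := hθ.artin w), ← hω.ker_eq E, MonoidHom.mem_ker,
    ← hω.restrictNormalHom_eq_of_absGaloisAbProj_eq (hθ.theta_artin_inv w).symm E,
    ← MonoidHom.mem_ker, IntermediateField.restrictNormalHom_ker]
  exact Iff.rfl

/-- **The Artin map of `θ` has the five characterising clauses** (`IsLocalArtinMap`), given the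
density of `W_F` in `Γ_F` (the named fact `WeilGroup.denseRange_toAbsGalois`, a theorem of the
tree): the four `LocalArtinData` clauses are those of `IsLocalReciprocityMap.toLocalArtinData`
(open quotient map, kernel `closure [W_F, W_F]`, `artin (I_F) = 𝒪_Fˣ`, geometric Frobenius `↦`
uniformiser; Tate (1.4.1), Serre XIV §6 Remark 2), the fifth is `artin_mem_range_norm_iff`.
[cite: SerreLocalFields1979, Ch. XIII §4 Thm. 1–2 and Prop. 13] -/
theorem isLocalArtinMap_artin (hθ : IsLocalReciprocityMap F hω.theta)
    (hdense : WeilGroup.denseRange_toAbsGalois F) : IsLocalArtinMap F hθ.artin where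
  isOpenQuotientMap_artin := hθ.isOpenQuotientMap_artin hdense
  ker_artin := hθ.coe_ker_artin hdense
  image_inertia := hθ.map_inertia_artin
  artin_frob := hθ.isUniformizer_artin
  artin_mem_range_norm_iff E _ _ w := hω.artin_mem_range_norm_iff hθ E w

/-- **The Artin map of a reciprocity system has the five clauses, unconditionally**: the limit map
`θ` of `ω` IS a reciprocity map (`isLocalReciprocityMap_theta`, its two norm-group inputs being the
theorems `universalNormSubgroup_eq_bot` — Serre XIV §6 Cor. 2 (i), from the Lubin–Tate norm
groups — and `isClosed_of_isNormSubgroup_holds`), and `W_F` is dense in `Γ_F`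
(`WeilGroup.denseRange_toAbsGalois_holds`).
[cite: SerreLocalFields1979, Ch. XIII §4 Thm. 1–2, Ch. XIV §6 Cor. 2 and Remark 2] -/
theorem isLocalArtinMap_artin_theta :
    IsLocalArtinMap F (hω.isLocalReciprocityMap_theta (universalNormSubgroup_eq_bot F)
      (isClosed_of_isNormSubgroup_holds F)).artin :=
  hω.isLocalArtinMap_artin _ (WeilGroup.denseRange_toAbsGalois_holds F)

end IsReciprocitySystem

section Assembly

variable (F : Type u) [Field F] [ValuativeRel F] [TopologicalSpace F] [IsNonarchimedeanLocalField F]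

/-- **`exists_isLocalArtinMap F` from a finite-level reciprocity system alone**: the Artin map of
the limit of any reciprocity system of `F` is a witness (`isLocalArtinMap_artin_theta`).
[cite: SerreLocalFields1979, Ch. XIII §4 Thm. 1–2] -/
theorem exists_isLocalArtinMap_of_exists_isReciprocitySystem (h : exists_isReciprocitySystem F) :
    exists_isLocalArtinMap F := by
  obtain ⟨ω, hω⟩ := h
  exact ⟨_, hω.isLocalArtinMap_artin_theta⟩

/-- **Local class field theory: the local Artin map with its characterising clauses exists** —
discharge of the named fact `exists_isLocalArtinMap F` (T0 debt of the Artin pin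
`canonicalArtin F` of the summit `Langlands`): for every non-archimedean local field `F` some
`artin : W_F →* Fˣ` is an open quotient map with kernel `closure [W_F, W_F]`, maps `I_F` onto
`𝒪_Fˣ`, sends geometric Frobenius elements to uniformisers, and satisfies the reciprocity law at
finite level `artin w ∈ N_{E/F}(Eˣ) ↔ w|_E = 1` for every finite abelian `E ⊆ F̄` (Milne, *Class
Field Theory* I Thm. 1.1 (a)–(b), restricted along `W_F ↪ Γ_F`; Serre, *Local Fields* XIII §4
Thm. 1–2, XIV §6 Remark 2; Tate (1.4.1)).  The witness is the Artin map of the limit of the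
finite-level reciprocity system of `F` (`LocalWeilDatum.exists_isReciprocitySystem_holds`,
Neukirch's route). [cite: SerreLocalFields1979, Ch. XIII §4 Thm. 2] -/
theorem exists_isLocalArtinMap_holds : exists_isLocalArtinMap F :=
  exists_isLocalArtinMap_of_exists_isReciprocitySystem F
    (LocalWeilDatum.exists_isReciprocitySystem_holds F)

/-- **The pinned Artin map `canonicalArtin F` has the five characterising clauses**,
unconditionally (`isLocalArtinMap_canonicalArtin` fed with `exists_isLocalArtinMap_holds`).
[cite: SerreLocalFields1979, Ch. XIII §4 Thm. 1–2] -/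
theorem isLocalArtinMap_canonicalArtin_holds : IsLocalArtinMap F (canonicalArtin F) :=
  isLocalArtinMap_canonicalArtin (exists_isLocalArtinMap_holds F)

end Assembly

end Literature.NumberTheory.GaloisRepresentations
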